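import Summits.HubbardSuperconductivity.HubbardSuperconductivity.Theorems.WeakCouplingBCSDefsKlCertTPrime
import Summits.HubbardSuperconductivity.HubbardSuperconductivity.Theorems.WeakCouplingBCSKlRidgeSplit

/-!
# The «caustic-window Schur split»: structured proxies for the two singular classes of the Kohn–Luttinger
# cell certificate (KL-MARGIN-SCAN HQ1 (iii), anomaly reading, round 9)

Reader seat hubbard-klscan-idea-1 (lens: anomaly), round 9; bears on the certificate half of
`Theses.WeakCouplingBCS.WcbcsKohnLuttingerB1g` (stmt-HubbardSuperconductivity-0158) through the first `t′ ≠ 0` cell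
`(δ, t′/t) = (⅛, −0.3)` of the director's HQ1 (iii) line, whose route-(J)/(P) certificate is OPEN at `N = 192` after margin-1 g15's
retraction (bus 2026-08-29 02:39Z / 02:59Z: corrected Monte-Carlo Hilbert–Schmidt budget `B_N ≈ 0.185` vs needed `≈ 0.163`).
HONEST FRAMING: a Kohn–Luttinger `O(U²)` channel statement is not ODLRO and nothing here proves superconductivity in the Hubbard
model; NO margin at any `t′ ≠ 0` is asserted; nothing is said about `K₃`, `U₀` or the onset window; the file contains NO numerical
record (floats in docstrings are motivation, never hypotheses); 0 sorry.

THE MEASURED ANOMALY (margin-1's 800 float-checked sample boxes, j323450, re-classified by the distance of the box's transfer momentum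
`q = k + h·k′` to the singular set `T ∪ {0}` of `χ₀`, `T = {2k : k ∈ Σ_μ}` the `2k_F`-CAUSTIC): 16.8 % of the boxes (dist `< 0.05`) carry
63.7 % of `B_N²`; of these the SAME-LIFT collar (both momenta on one smooth arc, angular separation `< 0.35`) is 9 % of the boxes and 31 %
of `B_N²`, concentrated on the arc `|θ − 45°| < 7.8°` of directions (seen from `M = (π,π)`) — exactly the arc of `T` that lies INSIDE its
umklapp mirror `T′ = σ_{q_x = π}(T)`, the two caustics crossing at `2 r(θ*) cos θ* = π`, `θ* = 37.18°` (float) — and the COOPER band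
(`h = C₂`, `q ≈ 0`) is 0.75 % of the boxes and 15.6 % of `B_N²`.  On both classes the certified hull widths (`0.07 – 0.26`) are enclosure
slop, not oscillation: the float kernel varies by `≤ 0.005` across a same-lift collar box and by `10⁻⁴` across the Cooper band.

THE LEVER.  Do not enclose `χ₀` box by box on the two singular classes; replace it there by STRUCTURED PROXIES whose quadratic forms have
a SIGN, inserted into the Galerkin matrices, and charge only the deviations, by the Schur test, through THREE SCALAR inputs:
* Hadamard partition of unity `K = K∘(1 − W − W_C) + K∘W + K∘W_C` with an explicit positive-semidefinite `[0,1]`-window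
  `W_ij = ψ_iψ_j·F(θ_i − θ_j)` on the same-lift collar (`ψ` a bump on the crossing arc, `F` a Fejér = box ⋆ box taper) and a Cooper band
  `W_C(i,j) = F_C(θ_i − θ_j − π)`;
* WINDOW PROXY `P = (√c √cᵀ)∘W`, `c(θ) = χ₀(2k(θ)) (+ δ)` the value of `χ₀` ON the caustic: `P ⪰ 0` by the (rank-one) SCHUR PRODUCT
  THEOREM (§2), so inserting `P` into a rival's matrix and dropping nothing costs only the deviation `D∘W`, `D = χ₀(k+k′) − √(c c′)`,
  `‖D∘W‖ ≤ η·m_W` (Schur test; `η` = ONE sup of `|D|` over the inner collar, `m_W` = the window's row mass);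
* COOPER PROXY `c₀·W_C`, `c₀ = χ₀(0)`: `W_C = F_C·Π` with `Π` the antipodal involution, so its form is `+`(Fejér form) on `C₂`-even functions
  (all four one-dimensional irreps) and `−`(Fejér form) on `C₂`-odd ones (`E`) (§4): free on the singlet rivals, `≤ c₀ m_C` on `E`, deviation
  `η_C·m_C` with `η_C` = the modulus of continuity of `χ₀` on the disc `|q| ≤ r_C` (where `χ₀` is smooth);
* on the `B1g` side the same proxy matrix is a legitimate Ritz matrix and the window remainder `ρ_B = η·⟨|v|, W|v|⟩_σ` is negligible
  because the `d_{x²−y²}` bottom vector is small on the crossing arc (node coincidence: 2 % of its `σ`-mass);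
* the bulk keeps route (P)'s Hilbert–Schmidt pair budget, now WITHOUT the two singular classes.
Floats at the cell (`r9/calc9`, pure python, M = 768 Fermi-surface nodes, 37 059 kernel values; window plateau `|θ−45°| ≤ 8°`, support `18°`,
taper `0.352 rad`; Cooper band `0.0245 rad`): `m_W = 0.34`, `η = 0.055` (`0.042` with `δ = 0.02`), true `‖(D∘W)|_χ‖ ≤ 0.0025`, matrix-bottom
shifts `≤ 2.1·10⁻⁴`, `ρ_B = 1.4·10⁻⁴`, `m_C = 0.056`, `η_C = 10⁻⁴`, `c₀ m_C = 0.013` (`E` only); margin-1's sample re-weighted by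
`(1 − W − W_C)²`: `B_N(192) = 0.1845 → 0.1492`; dominance test vs the binding rival `A2g`: status quo FAILS by `0.0247`, the split PASSES by
`+0.021` (row-Schur `ε`), `+0.006` (one-constant `ε = η m_W`), break-even `η* = 0.072` at `N = 192` and `η* ≈ 0.19` at `N = 256` (bulk `× 0.8`).
What is PROVED here is the finite-dimensional skeleton: §1 quadratic forms and Gram (Fejér-type) windows are PSD; §2 the rank-one Schur
product (the lever); §3 the matrix-level floor/ceiling of the window split (Weyl by forms, the deviation hypothesis being exactly what idea-2's landed weighted Schur
test `KlRidgeSplit.abs_sum_sum_mul_mul_le_of_superSolution` discharges); §4 the Cooper-band parity identity and its sign corollaries; §5 the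
hypothesis-carrying WINDOW-SPLIT CELL CERTIFICATE and its soundness down to the tree's conclusion `KLB1gDominatesAtTP` (p665271), of which
idea-2's `KLSplitCellCertificate` is the special case `P = 0`; §6 the three scalar inputs typed as Props over the tree's
`lindhardFunction (squareDispersion 1 tp) μ` (targets for margin-1 / analytic-1; no instance asserted).
References: R. A. Horn, C. R. Johnson, *Matrix Analysis* (2nd ed.) Thm 7.5.3 (Schur product theorem), Thm 4.3.1 (Weyl); I. Schur, J. reine
angew. Math. 140 (1911) 1–28; L. Grafakos, *Classical Fourier Analysis* App. A.2 (Schur test) = `Literature.Analysis.OperatorTheory.SchurTest`;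
W. Kohn, J. M. Luttinger, Phys. Rev. Lett. 15 (1965) 524 (the `2k_F` singularity as the pairing glue); S. Raghu, S. A. Kivelson,
D. J. Scalapino, Phys. Rev. B 81 (2010) 224505 §II–III; F. Stern, Phys. Rev. Lett. 18 (1967) 546 (2D Lindhard function: constant inside `2k_F`).
Lineage credited: idea-2 r9 «ridge-split-perron» (population split + weighted Schur; width-majorant Perron charge of the ring — here replaced by
signed structured proxies), idea-3 r4 R1–R3 (caustic geometry of the residual), margin-1 g15 ENGINE-J §11 (ring classes).
-/

noncomputable section

-- the tree's namespace convention repeats the summit name by design (D-0017)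
set_option linter.dupNamespace false

open Finset
open Literature.MathematicalPhysics.QuantumLattice
open Summit.HubbardSuperconductivity.HubbardSuperconductivity.Theorems

namespace Summit.HubbardSuperconductivity.HubbardSuperconductivity.Theorems.KlCausticWindow

variable {ι : Type*} [Fintype ι]

/-! ## §1 Quadratic forms of finite kernels; Gram windows are positive semidefinite -/

/-- The quadratic form `xᵀAx = ∑_ij A_ij x_i x_j` of a finite kernel. -/
def qform (A : ι → ι → ℝ) (x : ι → ℝ) : ℝ := ∑ i, ∑ j, A i j * x i * x j

/-- Positive semidefiniteness of a finite kernel, as a quadratic-form statement. -/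
def IsPSDKernel (A : ι → ι → ℝ) : Prop := ∀ x : ι → ℝ, 0 ≤ qform A x

/-- Additivity of the quadratic form in its kernel: `qform (A + B) x = qform A x + qform B x`. -/
theorem qform_add (A B : ι → ι → ℝ) (x : ι → ℝ) :
    qform (fun i j => A i j + B i j) x = qform A x + qform B x := by
  simp only [qform, add_mul, Finset.sum_add_distrib]

/-- The quadratic form of a difference of kernels: `qform (A − B) x = qform A x − qform B x`. -/
theorem qform_sub (A B : ι → ι → ℝ) (x : ι → ℝ) :
    qform (fun i j => A i j - B i j) x = qform A x - qform B x := by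
  simp only [qform, sub_mul, Finset.sum_sub_distrib]

/-- Homogeneity of the quadratic form in its kernel: `qform (c·A) x = c · qform A x`. -/
theorem qform_smul (c : ℝ) (A : ι → ι → ℝ) (x : ι → ℝ) :
    qform (fun i j => c * A i j) x = c * qform A x := by
  simp only [qform, Finset.mul_sum]
  exact Finset.sum_congr rfl fun i _ => Finset.sum_congr rfl fun j _ => by ring

/-- **Gram windows are PSD**: `W_ij = ∑_k φ_k(i) φ_k(j)` has `xᵀWx = ∑_k (∑_i φ_k(i) x_i)² ≥ 0`.  The Fejér / triangle taper of integer
half-width `s` on the `8N`-cycle is the Gram kernel of the `s` shifted boxes (box ⋆ box), and `ψ_iψ_j·W_ij` is the Gram kernel of `ψ·φ_k`;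
this is how the certificate's window is CHOSEN positive semidefinite with entries in `[0,1]`. [cite: HornJohnson2013, Theorem 7.2.7] -/
theorem isPSDKernel_gram {κ : Type*} [Fintype κ] (φ : κ → ι → ℝ) :
    IsPSDKernel (fun i j => ∑ k, φ k i * φ k j) := by
  intro x
  have h : qform (fun i j => ∑ k, φ k i * φ k j) x = ∑ k, (∑ i, φ k i * x i) * (∑ j, φ k j * x j) := by
    unfold qform
    calc ∑ i, ∑ j, (∑ k, φ k i * φ k j) * x i * x j
        = ∑ i, ∑ j, ∑ k, (φ k i * x i) * (φ k j * x j) := by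
          refine Finset.sum_congr rfl fun i _ => Finset.sum_congr rfl fun j _ => ?_
          rw [Finset.sum_mul, Finset.sum_mul]
          exact Finset.sum_congr rfl fun k _ => by ring
      _ = ∑ i, ∑ k, ∑ j, (φ k i * x i) * (φ k j * x j) :=
          Finset.sum_congr rfl fun i _ => Finset.sum_comm
      _ = ∑ k, ∑ i, ∑ j, (φ k i * x i) * (φ k j * x j) := Finset.sum_comm
      _ = ∑ k, (∑ i, φ k i * x i) * (∑ j, φ k j * x j) :=
          Finset.sum_congr rfl fun k _ => by rw [Finset.sum_mul_sum]
  rw [h]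
  exact Finset.sum_nonneg fun k _ => mul_self_nonneg _

/-! ## §2 THE LEVER: the rank-one Schur product theorem (window proxy `(√c√cᵀ)∘W ⪰ 0`) -/

/-- **Rank-one Schur product**: if `W` is PSD then so is the Hadamard product `(a aᵀ)∘W = (a_i a_j W_ij)` for ANY real vector `a`
(`xᵀ((aaᵀ)∘W)x = (a∘x)ᵀW(a∘x)`).  With `a = √c`, `c ≥ 0` the value of `χ₀` on the caustic (any nonnegative profile will do), this is the
statement that inserting the window proxy `P = (√c√cᵀ)∘W` into a rival's Galerkin matrix can only be UNDER-charged by dropping it — the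
structural replacement for per-box enclosures on the same-lift caustic collar. [cite: HornJohnson2013, Theorem 7.5.3 (Schur 1911)] -/
theorem isPSDKernel_rankOne_hadamard (W : ι → ι → ℝ) (hW : IsPSDKernel W) (a : ι → ℝ) :
    IsPSDKernel (fun i j => a i * a j * W i j) := by
  intro x
  have h := hW (fun i => a i * x i)
  have e : qform (fun i j => a i * a j * W i j) x = qform W (fun i => a i * x i) := by
    unfold qform
    exact Finset.sum_congr rfl fun i _ => Finset.sum_congr rfl fun j _ => by ring
  rw [e]
  exact h

/-- The proxy built from a nonnegative caustic profile `c` (entries `√(c_i)√(c_j) W_ij`) is PSD. -/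
theorem window_proxy_nonneg (W : ι → ι → ℝ) (hW : IsPSDKernel W) (c : ι → ℝ) (x : ι → ℝ) :
    0 ≤ qform (fun i j => Real.sqrt (c i) * Real.sqrt (c j) * W i j) x :=
  isPSDKernel_rankOne_hadamard W hW (fun i => Real.sqrt (c i)) x

/-! ## §3 The window split at matrix level: floor for a rival, ceiling for the `B1g` witness -/

/-- **Rival floor of the window split.**  `K = K_b + P + D` entrywise (bulk-and-proxy matrix `K_b + P` — the one whose bottom the
certificate bounds below by `L` — plus the window deviation `D = (K − proxy)∘W`) and `|xᵀDx| ≤ c‖x‖²` (discharged by the weighted Schur /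
Collatz–Wielandt test of idea-2's landed `KlRidgeSplit.abs_sum_sum_mul_mul_le_of_superSolution` with the majorant `|D_ij| ≤ η·W_ij`,
`c = η·m_W`): then `xᵀKx ≥ (L − c)‖x‖²` (Weyl at the level of forms). [cite: HornJohnson2013, Theorem 4.3.1, Theorem 8.1.26] -/
theorem floor_of_windowSplit {K Kb P D : ι → ι → ℝ} (hK : ∀ i j, K i j = (Kb i j + P i j) + D i j)
    {L : ℝ} (hL : ∀ x : ι → ℝ, L * ∑ i, x i ^ 2 ≤ qform (fun i j => Kb i j + P i j) x)
    {c : ℝ} (hdev : ∀ x : ι → ℝ, |qform D x| ≤ c * ∑ i, x i ^ 2) (x : ι → ℝ) :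
    (L - c) * ∑ i, x i ^ 2 ≤ qform K x := by
  have hsplit : qform K x = qform (fun i j => Kb i j + P i j) x + qform D x := by
    rw [← qform_add]
    unfold qform
    exact Finset.sum_congr rfl fun i _ => Finset.sum_congr rfl fun j _ => by rw [hK i j]
  have h1 := hL x
  have h2 := (abs_le.mp (hdev x)).1
  rw [hsplit]
  linarith

/-- `|D| ≤ Q` entrywise ⇒ `|xᵀDx| ≤ |x|ᵀQ|x|` (the majorant step; cf. `KlRidgeSplit.abs_sum_sum_mul_mul_le_of_majorant`). -/
theorem abs_qform_le_of_majorant (D Q : ι → ι → ℝ) (hDQ : ∀ i j, |D i j| ≤ Q i j) (x : ι → ℝ) :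
    |qform D x| ≤ ∑ i, ∑ j, Q i j * |x i| * |x j| := by
  unfold qform
  refine (Finset.abs_sum_le_sum_abs _ _).trans (Finset.sum_le_sum fun i _ => ?_)
  refine (Finset.abs_sum_le_sum_abs _ _).trans (Finset.sum_le_sum fun j _ => ?_)
  rw [abs_mul, abs_mul]
  exact mul_le_mul_of_nonneg_right (mul_le_mul_of_nonneg_right (hDQ i j) (abs_nonneg _)) (abs_nonneg _)

/-- **`B1g` ceiling of the window split.**  For the explicit Galerkin witness `v` (Ritz), `vᵀKv ≤ vᵀ(K_b + P)v + |v|ᵀQ|v|`: the proxy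
matrix is a legitimate trial matrix and the window remainder is paid ONCE on `|v|` — small because the `d_{x²−y²}` bottom vector nearly
vanishes on the crossing arc where the window lives. [cite: HornJohnson2013, Theorem 4.2.2 (Rayleigh–Ritz)] -/
theorem ceiling_of_windowSplit {K Kb P D : ι → ι → ℝ} (hK : ∀ i j, K i j = (Kb i j + P i j) + D i j)
    (Q : ι → ι → ℝ) (hDQ : ∀ i j, |D i j| ≤ Q i j) (v : ι → ℝ) :
    qform K v ≤ qform (fun i j => Kb i j + P i j) v + ∑ i, ∑ j, Q i j * |v i| * |v j| := by
  have hsplit : qform K v = qform (fun i j => Kb i j + P i j) v + qform D v := by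
    rw [← qform_add]
    unfold qform
    exact Finset.sum_congr rfl fun i _ => Finset.sum_congr rfl fun j _ => by rw [hK i j]
  have h2 := (abs_le.mp (abs_qform_le_of_majorant D Q hDQ v)).2
  rw [hsplit]
  linarith

/-- Dropping a PSD proxy can only LOWER a floor: if `K_b + P` has form `≥ L‖x‖²` is what one certifies, one may NOT certify `K_b` alone and
hope — but conversely a certified floor `L_b` of `K_b` alone plus `P ⪰ 0` gives the floor `L_b` for `K_b + P` (the crude use of §2 when the
proxy is not inserted into the interval matrix). -/
theorem floor_add_of_psd {Kb P : ι → ι → ℝ} (hP : IsPSDKernel P) {L : ℝ}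
    (hL : ∀ x : ι → ℝ, L * ∑ i, x i ^ 2 ≤ qform Kb x) (x : ι → ℝ) :
    L * ∑ i, x i ^ 2 ≤ qform (fun i j => Kb i j + P i j) x := by
  rw [qform_add]
  have := hP x
  have := hL x
  linarith

/-! ## §4 The Cooper band: parity makes the proxy `c₀·W_C` signed per sector -/

/-- **Parity identity.**  If `W_C(i,j) = F(i, τ j)` for an involution `τ` of the index set (the antipodal map `k ↦ C₂k` on each pocket) and
`f∘τ = s·f`, then `fᵀW_C f = s·fᵀF f`.  [folklore; cite: HornJohnson2013, §0.9.5 (permutation similarity)] -/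
theorem qform_permKernel (F : ι → ι → ℝ) (τ : Equiv.Perm ι) (hτ : ∀ j, τ (τ j) = j) (s : ℝ) (f : ι → ℝ)
    (hf : ∀ j, f (τ j) = s * f j) :
    qform (fun i j => F i (τ j)) f = s * qform F f := by
  unfold qform
  rw [Finset.mul_sum]
  refine Finset.sum_congr rfl fun i _ => ?_
  rw [Finset.mul_sum]
  have hf' : ∀ j, f j = s * f (τ j) := fun j => by
    have h := hf (τ j)
    rwa [hτ] at h
  calc ∑ j, F i (τ j) * f i * f j
      = ∑ j, (fun y => s * (F i y * f i * f y)) (τ j) :=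
        Finset.sum_congr rfl fun j _ => by simp only []; rw [hf' j]; ring
    _ = ∑ y, s * (F i y * f i * f y) := Equiv.sum_comp τ (fun y => s * (F i y * f i * f y))

/-- `C₂`-EVEN sector functions (all four one-dimensional irreps `A1g, A2g, B1g, B2g`): the Cooper-band proxy form is `+`(Fejér form) `≥ 0`
— the Cooper class is FREE on the singlet rivals. -/
theorem cooperBand_nonneg_of_even (F : ι → ι → ℝ) (hF : IsPSDKernel F) (τ : Equiv.Perm ι) (hτ : ∀ j, τ (τ j) = j)
    (f : ι → ℝ) (hf : ∀ j, f (τ j) = f j) : 0 ≤ qform (fun i j => F i (τ j)) f := by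
  rw [qform_permKernel F τ hτ 1 f (fun j => by rw [hf j, one_mul]), one_mul]
  exact hF f

/-- `C₂`-EVEN witness side: the proxy form is at most the Fejér form's bound `m·‖f‖²` (Schur row mass `m = c₀·m_C`). -/
theorem cooperBand_le_of_even (F : ι → ι → ℝ) (τ : Equiv.Perm ι) (hτ : ∀ j, τ (τ j) = j) {m : ℝ}
    (hFm : ∀ y : ι → ℝ, qform F y ≤ m * ∑ i, y i ^ 2) (f : ι → ℝ) (hf : ∀ j, f (τ j) = f j) :
    qform (fun i j => F i (τ j)) f ≤ m * ∑ i, f i ^ 2 := by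
  rw [qform_permKernel F τ hτ 1 f (fun j => by rw [hf j, one_mul]), one_mul]
  exact hFm f

/-- `C₂`-ODD sector functions (the two-dimensional irrep `E`): the proxy form is `−`(Fejér form) `≥ −m‖f‖²`, `m = c₀·m_C` the band's row mass —
the only place the Cooper class costs anything. -/
theorem cooperBand_ge_of_odd (F : ι → ι → ℝ) (τ : Equiv.Perm ι) (hτ : ∀ j, τ (τ j) = j) {m : ℝ}
    (hFm : ∀ y : ι → ℝ, qform F y ≤ m * ∑ i, y i ^ 2) (f : ι → ℝ) (hf : ∀ j, f (τ j) = -f j) :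
    -(m * ∑ i, f i ^ 2) ≤ qform (fun i j => F i (τ j)) f := by
  rw [qform_permKernel F τ hτ (-1) f (fun j => by rw [hf j]; ring)]
  have := hFm f
  linarith

/-! ## §5 The window-split cell certificate and its soundness -/

/-- **Window-split cell certificate** for the `t`–`t′` band at hopping ratio `tp` on the chemical-potential cell `[a, b]`
(hypothesis-carrying: every field is an obligation of the producer, nothing is claimed to exist).  `UB` / `LB χ` = certified bounds of the
Galerkin bottoms of the PROXY-CARRYING midpoint matrices (`K∘(1−W−W_C)·mid + (√c√cᵀ)∘W + c₀W_C`); `errB`, `errR` = the BULK residual's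
two sides, isotypically orthogonal with Hilbert–Schmidt budget `Bb` computed WITHOUT the window and the Cooper band; `ρ` = the `B1g`
witness remainder on window + band (§3 ceiling, §4 even side); `εW` = the window deviation's Schur bound (§3 floor, e.g. `η·m_W`);
`εC χ` = the Cooper band's cost on rival `χ` (§4: `η_C m_C` on the one-dimensional irreps, `η_C m_C + c₀ m_C` on `E`); `γ` the margin.
[cite: RaghuKivelsonScalapino2010, §II (7), (13); HornJohnson2013, Theorem 7.5.3, Theorem 4.3.1] -/
structure KLWindowSplitCertificate (tp a b : ℝ) where
  /-- certified upper bound of the `B1g` Galerkin bottom of the proxy-carrying matrix -/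
  UB : ℝ
  /-- certified lower bounds of the rival Galerkin bottoms of the proxy-carrying matrices (`min(·,0)` taken) -/
  LB : D4Irrep → ℝ
  /-- Hilbert–Schmidt budget of the bulk residual (window and Cooper band excluded) -/
  Bb : ℝ
  /-- `B1g` witness remainder on window + Cooper band -/
  ρ : ℝ
  /-- Schur bound of the window deviation `D∘W` -/
  εW : ℝ
  /-- cost of the Cooper band on rival `χ` -/
  εC : D4Irrep → ℝ
  /-- the margin -/
  γ : ℝ
  Bb_nonneg : 0 ≤ Bb
  /-- bulk error on the `B1g` side at `μ` -/
  errB : ℝ → ℝ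
  /-- bulk error on the rival side at `μ`, per rival -/
  errR : ℝ → D4Irrep → ℝ
  /-- the `B1g` CEILING (Ritz with the proxy-carrying matrix + bulk error + window/band remainder) -/
  ceiling : ∀ μ ∈ Set.Icc a b,
    channelInf (squareDispersion 1 tp) μ 1 D4Irrep.B1g ≤ UB + errB μ + ρ
  /-- the rival FLOORS (proxy-carrying Galerkin bound − bulk error − window deviation − Cooper cost) -/
  floor : ∀ μ ∈ Set.Icc a b, ∀ χ : D4Irrep, χ ≠ D4Irrep.B1g →
    LB χ - errR μ χ - εW - εC χ ≤ channelInf (squareDispersion 1 tp) μ 1 χ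
  /-- isotypic orthogonality of the bulk residual's Hilbert–Schmidt mass -/
  orth : ∀ μ ∈ Set.Icc a b, ∀ χ : D4Irrep, χ ≠ D4Irrep.B1g → errB μ ^ 2 + errR μ χ ^ 2 ≤ Bb ^ 2
  /-- the scalar dominance check, per rival -/
  check : ∀ χ : D4Irrep, χ ≠ D4Irrep.B1g → UB + Real.sqrt 2 * Bb + ρ + εW + εC χ + γ ≤ LB χ

/-- **Soundness of the window-split cell certificate**: it yields the tree's `t′`-row conclusion `KLB1gDominatesAtTP tp a b γ`.
Idea-2's `KlRidgeSplit.KLSplitCellCertificate` (no structured proxies: `P = 0`, ridge charged by its width majorant) is the special case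
`ρ = wr`, `εW = ηr`, `εC = 0`. [cite: RaghuKivelsonScalapino2010, §II (7), (13); HornJohnson2013, Theorem 4.3.1] -/
theorem klB1gDominatesAtTP_of_windowSplitCertificate {tp a b : ℝ} (C : KLWindowSplitCertificate tp a b) :
    KLB1gDominatesAtTP tp a b C.γ := by
  intro μ hμ χ hχ
  have hpair : C.errB μ + C.errR μ χ ≤ Real.sqrt 2 * C.Bb :=
    Summit.HubbardSuperconductivity.HubbardSuperconductivity.Theorems.KlRidgeSplit.add_le_sqrt_two_mul C.Bb_nonneg (C.orth μ hμ χ hχ)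
  have h₁ := C.ceiling μ hμ
  have h₂ := C.floor μ hμ χ hχ
  have h₃ := C.check χ hχ
  linarith

/-! ## §6 The three scalar inputs, typed over the tree's Lindhard function (targets; no instance asserted) -/

/-- `χ₀` of the `t`–`t′` band at `U`-free level: the tree's static Lindhard function of `squareDispersion 1 tp`. -/
def chi0TP (tp μ : ℝ) (q : Momentum) : ℝ := lindhardFunction (squareDispersion 1 tp) μ q

/-- The value of `χ₀` ON the `2k_F`-caustic above the Fermi point `k`: `c(k) := χ₀(2k)`. -/
def causticValueTP (tp μ : ℝ) (k : Momentum) : ℝ := chi0TP tp μ ((2 : ℝ) • k)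

/-- INPUT (C): the **Cooper-disc modulus** — `|χ₀(q) − χ₀(0)| ≤ η_C` for `‖q‖ ≤ r` (a smooth region of `χ₀`; float at the cell:
`η_C ≈ 10⁻⁴` for `r = 0.07`).  One enclosure on ONE small `q`-disc serves every Cooper-band box of every `N`. -/
def CooperDiscModulusTP (tp μ r ηC : ℝ) : Prop :=
  ∀ q : Momentum, ‖q‖ ≤ r → |chi0TP tp μ q - chi0TP tp μ 0| ≤ ηC

/-- The crossing window: Fermi points whose direction from `M = (π, π)` is within (chord) `β` of a zone diagonal — typed crudely as the
strip `| |k₀ − π| − |k₁ − π| | ≤ β` (any set containing the arc `|θ − 45°| < θ_c` will do; float `θ* = 37.18°` at the cell). -/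
def diagonalWindow (β : ℝ) : Set Momentum := {k | |(|k 0 - Real.pi|) - (|k 1 - Real.pi|)| ≤ β}

/-- INPUT (W): the **caustic-window deviation** — for Fermi points `k, k′` of the window at chord distance `≤ s` (same smooth arc),
`|χ₀(k + k′) − √((c(k)+δ)(c(k′)+δ))| ≤ η`: ONE sup over the inner collar of the caustic along the crossing arc (float at the cell:
`η = 0.055` at `δ = 0`, `0.042` at `δ = 0.02`, for `s ↔ 0.35 rad`; the certificate at `N = 192` needs `η ≤ 0.072`, at `N = 256` `η ≲ 0.19`). -/
def CausticWindowDeviationTP (tp μ β s δ η : ℝ) : Prop :=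
  ∀ k ∈ fermiCurve (squareDispersion 1 tp) μ ∩ diagonalWindow β,
    ∀ k' ∈ fermiCurve (squareDispersion 1 tp) μ ∩ diagonalWindow β, ‖k - k'‖ ≤ s →
      |chi0TP tp μ (k + k') - Real.sqrt ((causticValueTP tp μ k + δ) * (causticValueTP tp μ k' + δ))| ≤ η

/-- INPUT (V): the **caustic value range** on the window, `c(k) + δ ∈ [c_lo, c_hi]` with `0 ≤ c_lo` (needed only to build `√c` and to
enclose the proxy entries in the interval matrices; float `c ∈ [0.33, 0.43]` on the support, `[0.40, 0.43]` on the plateau). -/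
def CausticValueRangeTP (tp μ β δ clo chi : ℝ) : Prop :=
  0 ≤ clo ∧ ∀ k ∈ fermiCurve (squareDispersion 1 tp) μ ∩ diagonalWindow β, causticValueTP tp μ k + δ ∈ Set.Icc clo chi

/-- Monotonicity of the inputs in their tolerance (bookkeeping the producer will want). -/
theorem cooperDiscModulusTP_mono {tp μ r η η' : ℝ} (h : CooperDiscModulusTP tp μ r η) (hη : η ≤ η') :
    CooperDiscModulusTP tp μ r η' := fun q hq => (h q hq).trans hη

/-- Monotonicity of the caustic-window deviation target in its tolerance `η`. -/
theorem causticWindowDeviationTP_mono {tp μ β s δ η η' : ℝ} (h : CausticWindowDeviationTP tp μ β s δ η) (hη : η ≤ η') :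
    CausticWindowDeviationTP tp μ β s δ η' := fun k hk k' hk' hs => (h k hk k' hk' hs).trans hη

end Summit.HubbardSuperconductivity.HubbardSuperconductivity.Theorems.KlCausticWindow

end
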